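import Summits.HodgeConjecture.HodgeConjecture.Theorems.F0P3cStCharTSShellOn        -- ★ (F0P2-p02 (g15)) «SHELL-ON★»: `valued_det_lt_trace_sq_fst_of_mem_doubleCoset_prod`
import Summits.HodgeConjecture.HodgeConjecture.Theorems.F0P3cStCharTSHfHonOfSum    -- ★ p849886 (LH6-p04 (g3)): `forall_mem_tsupport_finset_sum_smul`
import Summits.HodgeConjecture.HodgeConjecture.Theorems.F0P3cStCharTSGShellData    -- ★ p849915 (this seat): `tsupport_indicator_doubleCoset_subset` (OPEN-subgroup form, no `T2Space` needed)
import Literature.NumberTheory.Automorphic.JacquetModule                           -- ★ `ParabolicTriple.IwahoriDatum` (`K`, `isOpen_K`)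
import HarnessLib

/-!
# F0 · P3c · line LH6 «StCharTS» — road (D) «DEEP-FL», brick «HFHON-OF-FH0★»: the `hfHon` hypothesis of ★ `isLocalDeltaTransfer_doubleCosetSum_of_checklist` (p849876)
# for the ACTUAL refined test function `f^H₀ = Σ_{u ∈ F} c_u · 𝟙_{K_H (u₂, u₁) K_H}`, `K_H = K′_{n′} × K₁`

Cell `pub/hodgecm-mathlib`, crux H413 = `stmt-HodgeConjecture-24833` (lane `--supports … --as helper`), route HCCMUnconditional; seat LH4-p02 (g3) on the road (D) owner LH6-p04 (g3)'s deal
«HFHON-OF-FH0★» (2026-09-02).  THEOREMS ONLY: no `def`, no instance, no notation, no `sorry`, no named fact.  HONEST LABEL: HC_CM is proved only modulo the 7 printed citations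
(2 remaining: hLiu418 = stmt-HodgeConjecture-24832, h413 = stmt-HodgeConjecture-24833) until rung 0 closes; count-neutral plumbing (one hypothesis of the TRANSFER third of «XIG-St»).

THE MATHEMATICS ([Rogawski1990, §4.3 (4.3.1) p. 43; §12.7 L. 12.7.3 (proof) p. 195]).  `H_v = U(Φ₂)(L⁺_v) × U(Φ₁)(L⁺_v)` at a non-split `v` (`w ∣ v`), `K_H = K′_{n′} × K₁` with `K′_{n′}` an
Iwahori level of `U(Φ₂)(L⁺_v)` of LEVEL `r < 1` in the one-place model `E₂` (entries within `r` of `1`) and `K₁ ≤ U(Φ₁)(L⁺_v)` open, and finitely many representatives `u ∈ F` whose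
`U(Φ₂)`-coordinates are HYPERBOLIC diagonals `E₂ u₂ = diag(e₀, e₁)`, `|e₀|_w ≠ |e₁|_w`, `|e₀|_w |e₁|_w = 1` (either orientation).  Then every point `x` of the support of
`f^H₀ = Σ_{u∈F} c_u 𝟙_{K_H u K_H}` is ON the stratum: `|det x₂|_w < |tr x₂|_w²`.  Indeed the support of the sum lies in the union of the supports of the summands (★ p849886
`forall_mem_tsupport_finset_sum_smul`), the support of `𝟙_{K_H u K_H}` lies in the clopen double coset `K_H u K_H` (★ p849915 `tsupport_indicator_doubleCoset_subset`, `K_H` open), and on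
`K_H u K_H` the first coordinate is ON (★ «SHELL-ON» `valued_det_lt_trace_sq_fst_of_mem_doubleCoset_prod`: a level-`r` perturbation of a hyperbolic diagonal keeps `|det| < |tr|²`).

* **`hfHon_fH0`** — the `hfHon` text of ★ p849876 VERBATIM for `fH := ∑ u ∈ F, cj u • (DoubleCoset.doubleCoset ((↑u.1 : U₂), u.2) ↑K_H ↑K_H).indicator fun _ => (1:ℂ)`,
  `K_H := (𝓘₂.K n′).prod K₁`, from `hr ∕ hK₂` (ShellOn's level text at `K₂ := 𝓘₂.K n′`), `hK₁ : IsOpen ↑K₁` and `hrep` (REP-HYPERBOLIC's `≠` shape);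
* `hfHon_fH0_indicator` — the single-summand case (`F = {u}`, no coefficient), same hypotheses.

## References
* [Rogawski1990] J. D. Rogawski, *Automorphic Representations of Unitary Groups in Three Variables*, Ann. of Math. Stud. 123 (1990): §4.3 (4.3.1) p. 43; §12.7 Lemma 12.7.3 (proof) p. 195.
* [Casselman1995] W. Casselman, *Introduction to the theory of admissible representations of `p`-adic reductive groups* (1995), Prop. 1.4.4 (Iwahori levels are compact open).
-/

set_option autoImplicit false
-- the mandated namespace has the single-problem summit's repeated segment (`HodgeConjecture.HodgeConjecture`)
set_option linter.dupNamespace false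

noncomputable section

open Matrix NumberField IsDedekindDomain
open scoped MatrixGroups Pointwise
open Literature.NumberTheory.Rogawski1990 Literature.NumberTheory.Automorphic Literature.NumberTheory.Automorphic.UnitaryGroup
open Literature.NumberTheory.GaloisRepresentations

namespace Summit.HodgeConjecture.HodgeConjecture.Cruxes.H413.F0P3cStCharTSHfHonOfFH0

variable (L : Type) [Field L] [NumberField L] [IsCMField L] (v : HeightOneSpectrum (𝓞 ↥(maximalRealSubfield L)))
  (w : PlacesOver L v) (hw : IsCMField.complexConj L • w.1 = w.1)

set_option maxHeartbeats 800000 in  -- statement-level `whnf` on the CM carriers (as ★ «SHELL-ON»)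
/-- **«HFHON-OF-FH0★», one shell**: for `K_H = K′_{n′} × K₁` (`K′_{n′} = 𝓘₂.K n′` of level `r < 1` under `E₂`, `K₁` open) and `u = (u₂, u₁) ∈ T₂ × U(Φ₁)_v` with `E₂ u₂ = diag(e₀, e₁)`
hyperbolic (`|e₀|_w ≠ |e₁|_w`, `|e₀|_w |e₁|_w = 1`): every `x ∈ tsupport 𝟙_{K_H u K_H}` has `|det x₂|_w < |tr x₂|_w²` (★ p849915 `tsupport_indicator_doubleCoset_subset` ∘ ★ «SHELL-ON»
`valued_det_lt_trace_sq_fst_of_mem_doubleCoset_prod`). [cite: Rogawski1990, §4.3 (4.3.1) p. 43; §12.7 L. 12.7.3 (proof) p. 195] [cite: Casselman1995, Prop. 1.4.4] -/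
theorem hfHon_fH0_indicator (𝓘₂ : (cmBorelTriple L 2 v).IwahoriDatum) (n' : ℕ)
    (K₁ : Subgroup ((cmDatum L 1 (Matrix.of fun i j : Fin 1 => if i.val + j.val + 1 = 1 then (1 : L) else 0)).Local v))
    (hK₁ : IsOpen (K₁ : Set ((cmDatum L 1 (Matrix.of fun i j : Fin 1 => if i.val + j.val + 1 = 1 then (1 : L) else 0)).Local v)))
    {r : WithZero (Multiplicative ℤ)} (hr : r < 1)
    (hK₂ : ∀ k ∈ 𝓘₂.K n', ∀ i j, Valued.v ((((localNonsplitEquiv (IsCMField.complexConj L) (Matrix.of fun i j : Fin 2 => if i.val + j.val + 1 = 2 then (1 : L) else 0)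
        (IsCMField.complexConj_ne_one L) w hw k :
        ↥(unitaryGroupOfForm (galAdicCompletionMap (L := L) (IsCMField.complexConj L) hw) (placeForm (Matrix.of fun i j : Fin 2 => if i.val + j.val + 1 = 2 then (1 : L) else 0) w.1))) :
        GL (Fin 2) (w.1.adicCompletion L)) : Matrix (Fin 2) (Fin 2) (w.1.adicCompletion L)) i j - (1 : Matrix (Fin 2) (Fin 2) (w.1.adicCompletion L)) i j) ≤ r)
    (u : ↥(cmBorelTriple L 2 v).M × (cmDatum L 1 (Matrix.of fun i j : Fin 1 => if i.val + j.val + 1 = 1 then (1 : L) else 0)).Local v)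
    {e₀ e₁ : w.1.adicCompletion L}
    (hu : (((localNonsplitEquiv (IsCMField.complexConj L) (Matrix.of fun i j : Fin 2 => if i.val + j.val + 1 = 2 then (1 : L) else 0) (IsCMField.complexConj_ne_one L) w hw
          (u.1 : ↥(unitaryGroupOfForm (conjLocal L (IsCMField.complexConj L) v) (cmLocalForm L 2 v))) :
        ↥(unitaryGroupOfForm (galAdicCompletionMap (L := L) (IsCMField.complexConj L) hw) (placeForm (Matrix.of fun i j : Fin 2 => if i.val + j.val + 1 = 2 then (1 : L) else 0) w.1))) :
        GL (Fin 2) (w.1.adicCompletion L)) : Matrix (Fin 2) (Fin 2) (w.1.adicCompletion L)) = Matrix.diagonal ![e₀, e₁])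
    (hne : Valued.v e₀ ≠ Valued.v e₁) (hprod : Valued.v e₀ * Valued.v e₁ = 1) :
    ∀ x ∈ tsupport ((DoubleCoset.doubleCoset
        (((u.1 : ↥(unitaryGroupOfForm (conjLocal L (IsCMField.complexConj L) v) (cmLocalForm L 2 v))), u.2) :
          ↥(unitaryGroupOfForm (conjLocal L (IsCMField.complexConj L) v) (cmLocalForm L 2 v)) ×
            (cmDatum L 1 (Matrix.of fun i j : Fin 1 => if i.val + j.val + 1 = 1 then (1 : L) else 0)).Local v)
        (((𝓘₂.K n').prod K₁ : Subgroup (↥(unitaryGroupOfForm (conjLocal L (IsCMField.complexConj L) v) (cmLocalForm L 2 v)) ×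
            (cmDatum L 1 (Matrix.of fun i j : Fin 1 => if i.val + j.val + 1 = 1 then (1 : L) else 0)).Local v)) : Set _)
        ((𝓘₂.K n').prod K₁ : Subgroup (↥(unitaryGroupOfForm (conjLocal L (IsCMField.complexConj L) v) (cmLocalForm L 2 v)) ×
            (cmDatum L 1 (Matrix.of fun i j : Fin 1 => if i.val + j.val + 1 = 1 then (1 : L) else 0)).Local v))).indicator fun _ => (1 : ℂ)),
      Valued.v ((Pi.evalRingHom (fun w' : PlacesOver L v => w'.1.adicCompletion L) w) ((x.1.val : GL (Fin 2) (LocalRing L v)) : Matrix (Fin 2) (Fin 2) (LocalRing L v)).det) <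
        Valued.v ((Pi.evalRingHom (fun w' : PlacesOver L v => w'.1.adicCompletion L) w) ((x.1.val : GL (Fin 2) (LocalRing L v)) : Matrix (Fin 2) (Fin 2) (LocalRing L v)).trace) ^ 2 := by
  intro x hx
  have hKH : IsOpen (((𝓘₂.K n').prod K₁ : Subgroup (↥(unitaryGroupOfForm (conjLocal L (IsCMField.complexConj L) v) (cmLocalForm L 2 v)) ×
      (cmDatum L 1 (Matrix.of fun i j : Fin 1 => if i.val + j.val + 1 = 1 then (1 : L) else 0)).Local v)) :
      Set (↥(unitaryGroupOfForm (conjLocal L (IsCMField.complexConj L) v) (cmLocalForm L 2 v)) ×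
        (cmDatum L 1 (Matrix.of fun i j : Fin 1 => if i.val + j.val + 1 = 1 then (1 : L) else 0)).Local v)) := by
    rw [Subgroup.coe_prod]
    exact (𝓘₂.isOpen_K n').prod hK₁
  have hmem := F0P3cStCharTSGShellData.tsupport_indicator_one_doubleCoset_subset _ hKH _ hx
  exact F0P3cStCharTSShellOn.valued_det_lt_trace_sq_fst_of_mem_doubleCoset_prod L v w hw (𝓘₂.K n') K₁ hr hK₂ hu hne hprod hmem

set_option maxHeartbeats 800000 in  -- statement-level `whnf` on the CM carriers (as ★ «SHELL-ON»)
/-- **«HFHON-OF-FH0★» — the `hfHon` hypothesis of ★ `isLocalDeltaTransfer_doubleCosetSum_of_checklist` (p849876) for `f^H₀ = Σ_{u∈F} c_u 𝟙_{K_H (u₂,u₁) K_H}`, `K_H = K′_{n′} × K₁`:**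
given the level `r < 1` of `K′_{n′} = 𝓘₂.K n′` under `E₂` (`hr`, `hK₂` — «SHELL-ON»'s texts), `K₁` open, and for every representative `u ∈ F` a hyperbolic diagonal `E₂ u₂ = diag(e₀, e₁)`,
`|e₀|_w ≠ |e₁|_w`, `|e₀|_w |e₁|_w = 1` (`hrep` — «REP-HYPERBOLIC»'s shape), EVERY `x ∈ tsupport f^H₀` satisfies `|det x₂|_w < |tr x₂|_w²` (the conclusion in ★ p849876's `Pi.evalRingHom … w`
spelling, token for token).  Proof: ★ p849886 `forall_mem_tsupport_finset_sum_smul` over the one-shell lemma `hfHon_fH0_indicator`.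
[cite: Rogawski1990, §4.3 (4.3.1) p. 43; §12.7 L. 12.7.3 (proof) p. 195] [cite: Casselman1995, Prop. 1.4.4] -/
theorem hfHon_fH0 (𝓘₂ : (cmBorelTriple L 2 v).IwahoriDatum) (n' : ℕ)
    (K₁ : Subgroup ((cmDatum L 1 (Matrix.of fun i j : Fin 1 => if i.val + j.val + 1 = 1 then (1 : L) else 0)).Local v))
    (hK₁ : IsOpen (K₁ : Set ((cmDatum L 1 (Matrix.of fun i j : Fin 1 => if i.val + j.val + 1 = 1 then (1 : L) else 0)).Local v)))
    {r : WithZero (Multiplicative ℤ)} (hr : r < 1)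
    (hK₂ : ∀ k ∈ 𝓘₂.K n', ∀ i j, Valued.v ((((localNonsplitEquiv (IsCMField.complexConj L) (Matrix.of fun i j : Fin 2 => if i.val + j.val + 1 = 2 then (1 : L) else 0)
        (IsCMField.complexConj_ne_one L) w hw k :
        ↥(unitaryGroupOfForm (galAdicCompletionMap (L := L) (IsCMField.complexConj L) hw) (placeForm (Matrix.of fun i j : Fin 2 => if i.val + j.val + 1 = 2 then (1 : L) else 0) w.1))) :
        GL (Fin 2) (w.1.adicCompletion L)) : Matrix (Fin 2) (Fin 2) (w.1.adicCompletion L)) i j - (1 : Matrix (Fin 2) (Fin 2) (w.1.adicCompletion L)) i j) ≤ r)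
    (F : Finset (↥(cmBorelTriple L 2 v).M × (cmDatum L 1 (Matrix.of fun i j : Fin 1 => if i.val + j.val + 1 = 1 then (1 : L) else 0)).Local v))
    (cj : ↥(cmBorelTriple L 2 v).M × (cmDatum L 1 (Matrix.of fun i j : Fin 1 => if i.val + j.val + 1 = 1 then (1 : L) else 0)).Local v → ℂ)
    (hrep : ∀ u ∈ F, ∃ e₀ e₁ : w.1.adicCompletion L,
      (((localNonsplitEquiv (IsCMField.complexConj L) (Matrix.of fun i j : Fin 2 => if i.val + j.val + 1 = 2 then (1 : L) else 0) (IsCMField.complexConj_ne_one L) w hw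
          (u.1 : ↥(unitaryGroupOfForm (conjLocal L (IsCMField.complexConj L) v) (cmLocalForm L 2 v))) :
        ↥(unitaryGroupOfForm (galAdicCompletionMap (L := L) (IsCMField.complexConj L) hw) (placeForm (Matrix.of fun i j : Fin 2 => if i.val + j.val + 1 = 2 then (1 : L) else 0) w.1))) :
        GL (Fin 2) (w.1.adicCompletion L)) : Matrix (Fin 2) (Fin 2) (w.1.adicCompletion L)) = Matrix.diagonal ![e₀, e₁] ∧
      Valued.v e₀ ≠ Valued.v e₁ ∧ Valued.v e₀ * Valued.v e₁ = 1) :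
    ∀ x ∈ tsupport (∑ u ∈ F, cj u • (DoubleCoset.doubleCoset
        (((u.1 : ↥(unitaryGroupOfForm (conjLocal L (IsCMField.complexConj L) v) (cmLocalForm L 2 v))), u.2) :
          ↥(unitaryGroupOfForm (conjLocal L (IsCMField.complexConj L) v) (cmLocalForm L 2 v)) ×
            (cmDatum L 1 (Matrix.of fun i j : Fin 1 => if i.val + j.val + 1 = 1 then (1 : L) else 0)).Local v)
        (((𝓘₂.K n').prod K₁ : Subgroup (↥(unitaryGroupOfForm (conjLocal L (IsCMField.complexConj L) v) (cmLocalForm L 2 v)) ×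
            (cmDatum L 1 (Matrix.of fun i j : Fin 1 => if i.val + j.val + 1 = 1 then (1 : L) else 0)).Local v)) : Set _)
        ((𝓘₂.K n').prod K₁ : Subgroup (↥(unitaryGroupOfForm (conjLocal L (IsCMField.complexConj L) v) (cmLocalForm L 2 v)) ×
            (cmDatum L 1 (Matrix.of fun i j : Fin 1 => if i.val + j.val + 1 = 1 then (1 : L) else 0)).Local v))).indicator fun _ => (1 : ℂ)),
      Valued.v ((Pi.evalRingHom (fun w' : PlacesOver L v => w'.1.adicCompletion L) w) ((x.1.val : GL (Fin 2) (LocalRing L v)) : Matrix (Fin 2) (Fin 2) (LocalRing L v)).det) <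
        Valued.v ((Pi.evalRingHom (fun w' : PlacesOver L v => w'.1.adicCompletion L) w) ((x.1.val : GL (Fin 2) (LocalRing L v)) : Matrix (Fin 2) (Fin 2) (LocalRing L v)).trace) ^ 2 := by
  refine F0P3cStCharTSHfHonOfSum.forall_mem_tsupport_finset_sum_smul F cj _ _ fun u hu x hx => ?_
  obtain ⟨e₀, e₁, he, hne, hprod⟩ := hrep u hu
  exact hfHon_fH0_indicator L v w hw 𝓘₂ n' K₁ hK₁ hr hK₂ u he hne hprod x hx

end Summit.HodgeConjecture.HodgeConjecture.Cruxes.H413.F0P3cStCharTSHfHonOfFH0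

end
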